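import Mathlib
import HarnessLib
import Summits.NavierStokesRegularity.NavierStokesRegularity.Theorems.ThreadingFluxHorizonTowerZonalFrame

/-!
# Route `UnthreadedDoor`, crux `PoloidalLiouville` (stmt-NavierStokesRegularity-1222), WALL W1 — crux idea «cell-flux» (ns-idea-14), stub Σ-5a
# `UnthreadedGaugeRigidity`: ℝ³ ALGEBRA for the short road (triple products, the reciprocal-basis expansion, the rank-≤-2 lemma, curl of a translate)

Elementary identities on `E3 = EuclideanSpace ℝ (Fin 3)` with the tree's `cross` / `curl` (`Literature.Analysis.FluidPDE.VectorCalculus`), used by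
`CellFlux.unthreadedGaugeRigidity` (director-ns KEY-NS #218 (2)(b), owner ns-qj-p1 g7); the coordinate formulas `HorizonTower.cross_fin3`,
`Literature.Geometry.DiscreteGeometry.inner_fin3` and `HorizonTower.Zonal.inner_cross_self_right` (`⟪a × b, b⟫ = 0`: an unthreaded vorticity
`∇T × (x − x₀)` is orthogonal to `x − x₀`) are IMPORTED (ThreadingFluxHorizonTowerZonalForm/Frame), not restated:
* `inner_cross_left_eq_neg` — `⟪a × s, w⟫ = −⟪s, a × w⟫`;
* `triple_smul_expand` — the reciprocal-basis expansion `⟪a, b × c⟫ • z = ⟪a, z⟫ • (b × c) + ⟪b, z⟫ • (c × a) + ⟪c, z⟫ • (a × b)` for ALL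
  `a b c z` (so «`det M · z = adj(M) α`» needs no invertibility and no case split);
* `exists_ne_zero_forall_inner_eq_zero` — if every triple product `⟪ω i, ω j × ω k⟫` of a family vanishes, some `e ≠ 0` is orthogonal to the
  whole family (the «zonal» branch of Σ-5a; cases: family zero / all parallel to one `a ≠ 0` / `e = ω j × ω k ≠ 0`);
* `curl_translate_sub_const` — `curl (y ↦ u (y + a) − c) y = curl u (y + a)`.
Nothing here is specific to Navier–Stokes; no NS regularity statement is proved.  `--supports stmt-NavierStokesRegularity-1222 --as helper`.  [folklore]
-/

noncomputable section

-- the summit and its single sub-problem share the name (CONVENTIONS §1)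
set_option linter.dupNamespace false

open Set Function Filter Topology InnerProductSpace
open scoped RealInnerProductSpace

namespace Summit.NavierStokesRegularity.NavierStokesRegularity.Theorems.PoloidalLiouville.CellFlux

open Literature.Analysis Literature.Analysis.FluidPDE
open Summit.NavierStokesRegularity.NavierStokesRegularity.Theorems.PoloidalLiouville.HorizonTower (E3 cross_fin3)
open Literature.Geometry.DiscreteGeometry (inner_fin3)

/-- `⟪a × s, w⟫ = −⟪s, a × w⟫`. [folklore] -/
theorem inner_cross_left_eq_neg (a s w : E3) : ⟪cross a s, w⟫ = -⟪s, cross a w⟫ := by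
  obtain ⟨h0, h1, h2⟩ := cross_fin3 a s
  obtain ⟨k0, k1, k2⟩ := cross_fin3 a w
  rw [inner_fin3, inner_fin3, h0, h1, h2, k0, k1, k2]
  ring

/-- `⟪a × b, c⟫ = ⟪c, a × b⟫` written as the triple product with `c` in front: `⟪a × b, w⟫ = ⟪w, a × b⟫` (symmetry of the real inner product).
[folklore] -/
theorem inner_cross_comm (a b w : E3) : ⟪cross a b, w⟫ = ⟪w, cross a b⟫ := real_inner_comm _ _

/-- **Reciprocal-basis expansion**: `⟪a, b × c⟫ • z = ⟪a, z⟫ • (b × c) + ⟪b, z⟫ • (c × a) + ⟪c, z⟫ • (a × b)` for all `a b c z ∈ ℝ³`. [folklore] -/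
theorem triple_smul_expand (a b c z : E3) :
    ⟪a, cross b c⟫ • z = ⟪a, z⟫ • cross b c + ⟪b, z⟫ • cross c a + ⟪c, z⟫ • cross a b := by
  obtain ⟨p0, p1, p2⟩ := cross_fin3 b c
  obtain ⟨q0, q1, q2⟩ := cross_fin3 c a
  obtain ⟨r0, r1, r2⟩ := cross_fin3 a b
  ext i
  fin_cases i <;>
    simp only [PiLp.add_apply, PiLp.smul_apply, smul_eq_mul, inner_fin3, Fin.zero_eta, Fin.mk_one, Fin.reduceFinMk,
      Fin.isValue] <;>
    simp only [p0, p1, p2, q0, q1, q2, r0, r1, r2] <;> ring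

/-- A nonzero vector of `ℝ³` has a nonzero cross product with some vector (one of the first two basis vectors). [folklore] -/
theorem exists_cross_ne_zero {a : E3} (ha : a ≠ 0) : ∃ s : E3, cross a s ≠ 0 := by
  by_contra h
  push Not at h
  have h0 := cross_fin3 a (WithLp.toLp 2 ![1, 0, 0])
  have h1 := cross_fin3 a (WithLp.toLp 2 ![0, 1, 0])
  rw [h (WithLp.toLp 2 ![1, 0, 0])] at h0
  rw [h (WithLp.toLp 2 ![0, 1, 0])] at h1
  simp only [PiLp.zero_apply, Matrix.cons_val_zero, Matrix.cons_val_one, Matrix.cons_val_two,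
    Matrix.head_cons, Matrix.tail_cons, mul_zero, mul_one, zero_sub, sub_zero] at h0 h1
  apply ha
  ext i
  fin_cases i
  · simp only [PiLp.zero_apply, Fin.zero_eta, Fin.isValue]; linarith [h1.2.2]
  · simp only [PiLp.zero_apply, Fin.mk_one, Fin.isValue]; linarith [h0.2.2]
  · simp only [PiLp.zero_apply, Fin.reduceFinMk, Fin.isValue]; linarith [h0.2.1]

/-- **Rank ≤ 2 lemma.**  If every triple product of a family of vectors of `ℝ³` vanishes, some nonzero vector is orthogonal to the whole family.
[folklore] -/
theorem exists_ne_zero_forall_inner_eq_zero {ι : Type*} (ω : ι → E3)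
    (h : ∀ i j k, ⟪ω i, cross (ω j) (ω k)⟫ = 0) : ∃ e : E3, e ≠ 0 ∧ ∀ i, ⟪e, ω i⟫ = 0 := by
  by_cases hall : ∀ i, ω i = 0
  · refine ⟨WithLp.toLp 2 ![1, 0, 0], ?_, fun i => by rw [hall i, inner_zero_right]⟩
    intro h0
    have := congrArg (fun v : E3 => v 0) h0
    simp at this
  · push Not at hall
    obtain ⟨i₁, hi₁⟩ := hall
    by_cases hpar : ∀ i, cross (ω i₁) (ω i) = 0
    · obtain ⟨s, hs⟩ := exists_cross_ne_zero hi₁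
      refine ⟨cross (ω i₁) s, hs, fun i => ?_⟩
      rw [inner_cross_left_eq_neg, hpar i, inner_zero_right, neg_zero]
    · push Not at hpar
      obtain ⟨i₂, hi₂⟩ := hpar
      refine ⟨cross (ω i₁) (ω i₂), hi₂, fun i => ?_⟩
      rw [inner_cross_comm]
      exact h i i₁ i₂

/-- **Curl of a translate**: `curl (y ↦ u (y + a) − c) y = curl u (y + a)` (the curl is defined from `fderiv` only). [folklore] -/
theorem curl_translate_sub_const (u : E3 → E3) (a c y : E3) :
    curl (fun y => u (y + a) - c) y = curl u (y + a) := by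
  have h : fderiv ℝ (fun y => u (y + a) - c) y = fderiv ℝ u (y + a) := by
    rw [fderiv_sub_const, fderiv_comp_add_right]
  simp only [curl, h]

end Summit.NavierStokesRegularity.NavierStokesRegularity.Theorems.PoloidalLiouville.CellFlux

end
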